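import Literature.NumberTheory.LFunctions.RayClassPartialZetaResidue
import Literature.NumberTheory.LFunctions.DedekindZetaFiniteOrderProofs
import HarnessLib

/-!
# Growth of the entire part of the signed coset series and of the ray class partial zeta functions

Topic `Literature/NumberTheory/LFunctions`; namespace `Literature.NumberTheory.LFunctions`.  Pure-proof
companion of `RayClassPartialZetaResidue.lean` (Hecke's continuation of the partial zeta functions of the
narrow ray classes `mod 𝔪`, Neukirch VII (8.5) with Remark 1 after (8.6)) and of the growth bookkeeping of
`DedekindZetaFiniteOrderProofs.lean` (bounds `‖F(s)‖ ≤ A exp(c‖s‖²)` on vertical strips `|Re s| ≤ R`).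
Everything here is PROVED; no definition and no named fact is introduced.

Hecke's integral representation gives more than holomorphy: the entire functions it produces are of finite
order (Neukirch VII (1.4), proof: `Λ₀` is bounded in vertical strips; Rademacher 1959 §5 uses exactly this
a-priori growth to run the Phragmén–Lindelöf argument for Hecke's `L`-functions with Größencharacters).  We
re-run the continuation of `RayClassPartialZetaResidue.lean` keeping track of the growth:

* (private helpers) divided differences `dslope G a` of an entire `G` inherit growth `A exp(c‖s‖²)` on vertical
  strips; `A_p(s/2)⁻¹` (inverse Gamma factor of sign type `p`) has growth `exp(O(‖s‖²))` on `|Re s| ≤ R`;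
* `NumberField.exists_entire_signedCosetSum_eq_add_div_growth` — the entire part `E_p` of the signed coset
  series `D_p(s) = E_p(s) + c_p/(s−1)` (`exists_entire_signedCosetSum_eq_add_div`) satisfies
  `‖E_p(s)‖ ≤ A_R exp(c_R ‖s‖²)` on every strip `|Re s| ≤ R`;
* `exists_rayClassPartialZeta_eq_add_div_growth` — Neukirch VII (5.11) for narrow ray classes WITH GROWTH:
  `Z_𝔪(𝔟, s) = Z₀^𝔟(s) + ρ_𝔪/(s−1)` with `Z₀^𝔟` entire of growth `exp(O(‖s‖²))` on vertical strips.

The consumer is `RayClassLSeriesGrowth.lean` (the `L`-series of a non-principal ray class character is entire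
of finite order — the a-priori bound for the convexity / zero-counting estimates of Hecke `L`-functions in
the Linnik range).

## References

* J. Neukirch, *Algebraic Number Theory*, Grundlehren 322, Springer 1999, Ch. VII §1 (1.4) (proof), §5
  (5.11), §8 (8.5) and Remark 1 after (8.6). [NeukirchANT1999]
* H. Rademacher, *On the Phragmén–Lindelöf theorem and some applications*, Math. Z. 72 (1959), 192–204, §5
  (Hecke `L`-functions). [Rademacher1959]
-/

noncomputable section

open Complex NumberField NumberField.InfinitePlace NumberField.Units IsDedekindDomain Filter Topology Set Metric
open scoped NumberField nonZeroDivisors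
open scoped Classical

namespace Literature.NumberTheory.LFunctions

namespace NumberField

variable {K : Type*} [Field K] [NumberField K]

/-! ### Divided differences keep the growth -/

omit [NumberField K] in
/-- **Divided differences of an entire function of growth `exp(O(‖s‖²))` on a strip have the same growth
there**: inside the unit disc around `a` the entire function `dslope G a` is bounded, outside
`‖(G(s) − G(a))/(s − a)‖ ≤ ‖G(s)‖ + ‖G(a)‖`. [folklore] -/
private theorem growth_dslope {G : ℂ → ℂ} (hG : Differentiable ℂ G) (a : ℂ) {R : ℝ}
    (hgr : ∃ A c : ℝ, 0 ≤ A ∧ 0 ≤ c ∧ ∀ s ∈ {s : ℂ | |s.re| ≤ R}, ‖G s‖ ≤ A * Real.exp (c * ‖s‖ ^ 2)) :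
    ∃ A c : ℝ, 0 ≤ A ∧ 0 ≤ c ∧ ∀ s ∈ {s : ℂ | |s.re| ≤ R},
      ‖dslope G a s‖ ≤ A * Real.exp (c * ‖s‖ ^ 2) := by
  obtain ⟨A, c, hA, hc, h⟩ := hgr
  -- the entire function `dslope G a` is bounded on the closed unit disc around `a`
  have hd : Differentiable ℂ (dslope G a) :=
    differentiableOn_univ.mp ((Complex.differentiableOn_dslope Filter.univ_mem).mpr hG.differentiableOn)
  obtain ⟨M, hM⟩ := (isCompact_closedBall a 1).exists_bound_of_continuousOn hd.continuous.continuousOn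
  have hM0 : 0 ≤ M := le_trans (norm_nonneg _) (hM a (mem_closedBall_self zero_le_one))
  refine ⟨A + ‖G a‖ + M, c, by positivity, hc, fun s hs ↦ ?_⟩
  have he1 : 1 ≤ Real.exp (c * ‖s‖ ^ 2) := Real.one_le_exp (by positivity)
  by_cases hsa : dist s a ≤ 1
  · calc ‖dslope G a s‖ ≤ M := hM s (mem_closedBall.mpr hsa)
      _ ≤ (A + ‖G a‖ + M) * 1 := by nlinarith [norm_nonneg (G a)]
      _ ≤ (A + ‖G a‖ + M) * Real.exp (c * ‖s‖ ^ 2) :=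
          mul_le_mul_of_nonneg_left he1 (by positivity)
  · push Not at hsa
    have hne : s ≠ a := fun h' ↦ by rw [h', dist_self] at hsa; linarith
    have hsa' : 1 ≤ ‖s - a‖ := by rw [← dist_eq_norm]; exact hsa.le
    rw [dslope_of_ne _ hne, slope_def_field, norm_div]
    calc ‖G s - G a‖ / ‖s - a‖ ≤ ‖G s - G a‖ / 1 :=
          div_le_div_of_nonneg_left (norm_nonneg _) one_pos hsa'
      _ ≤ ‖G s‖ + ‖G a‖ := by rw [div_one]; exact norm_sub_le _ _
      _ ≤ A * Real.exp (c * ‖s‖ ^ 2) + ‖G a‖ * Real.exp (c * ‖s‖ ^ 2) := by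
          have := h s hs
          nlinarith [norm_nonneg (G a)]
      _ ≤ (A + ‖G a‖ + M) * Real.exp (c * ‖s‖ ^ 2) := by nlinarith [Real.exp_pos (c * ‖s‖ ^ 2)]

/-! ### The inverse Gamma factor of sign type `p` on vertical strips -/

omit [NumberField K] in
/-- `Γ(e s + h)⁻¹` for real `e`, `h` has growth `exp(O(‖s‖²))` on vertical strips. [folklore] -/
private theorem growth_inv_Gamma_const_mul_add_real (e : ℂ) (he : e.im = 0) (h₀ : ℝ) {R : ℝ} (hR : 0 ≤ R) :
    ∃ A c : ℝ, 0 ≤ A ∧ 0 ≤ c ∧ ∀ s ∈ {s : ℂ | |s.re| ≤ R},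
      ‖(fun s : ℂ ↦ (Complex.Gamma (e * s + h₀))⁻¹) s‖ ≤ A * Real.exp (c * ‖s‖ ^ 2) := by
  obtain ⟨A, c, hA, hc, h⟩ := exists_norm_inv_Gamma_le_of_abs_re_le (S := |e.re| * R + |h₀|) (by positivity)
  refine ⟨A * Real.exp (2 * c * h₀ ^ 2), 2 * c * ‖e‖ ^ 2, by positivity, by positivity, fun s hs ↦ ?_⟩
  have hs' : |s.re| ≤ R := hs
  have hre : |(e * s + h₀).re| ≤ |e.re| * R + |h₀| := by
    rw [Complex.add_re, Complex.ofReal_re, Complex.mul_re, he, zero_mul, sub_zero]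
    calc |e.re * s.re + h₀| ≤ |e.re * s.re| + |h₀| := abs_add_le _ _
      _ = |e.re| * |s.re| + |h₀| := by rw [abs_mul]
      _ ≤ |e.re| * R + |h₀| := by gcongr
  have hn : ‖e * s + h₀‖ ^ 2 ≤ 2 * h₀ ^ 2 + 2 * (‖e‖ ^ 2 * ‖s‖ ^ 2) := by
    have h1 : ‖e * s + h₀‖ ≤ ‖e‖ * ‖s‖ + |h₀| := by
      calc ‖e * s + (h₀ : ℂ)‖ ≤ ‖e * s‖ + ‖(h₀ : ℂ)‖ := norm_add_le _ _
        _ = ‖e‖ * ‖s‖ + |h₀| := by rw [norm_mul, Complex.norm_real, Real.norm_eq_abs]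
    have h2 : ‖e * s + h₀‖ ^ 2 ≤ (‖e‖ * ‖s‖ + |h₀|) ^ 2 := pow_le_pow_left₀ (norm_nonneg _) h1 2
    have h3 : |h₀| ^ 2 = h₀ ^ 2 := sq_abs h₀
    nlinarith [sq_nonneg (‖e‖ * ‖s‖ - |h₀|), mul_pow ‖e‖ ‖s‖ 2]
  calc ‖(Complex.Gamma (e * s + h₀))⁻¹‖ ≤ A * Real.exp (c * ‖e * s + h₀‖ ^ 2) := h _ hre
    _ ≤ A * Real.exp (c * (2 * h₀ ^ 2 + 2 * (‖e‖ ^ 2 * ‖s‖ ^ 2))) :=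
        mul_le_mul_of_nonneg_left (Real.exp_le_exp.mpr (mul_le_mul_of_nonneg_left hn hc)) hA
    _ = A * Real.exp (2 * c * h₀ ^ 2) * Real.exp (2 * c * ‖e‖ ^ 2 * ‖s‖ ^ 2) := by
        rw [mul_assoc A, ← Real.exp_add]; congr 2; ring

omit [NumberField K] in
/-- The factor `(π e_w)^{e_w s/2 + h_w}` (as `((1/(π e_w))^{e_w (s/2) + h_w})⁻¹`) is bounded on vertical strips.
[folklore] -/
private theorem growth_inv_piFactor_halfWeight (p : Finset {w : InfinitePlace K // IsReal w}) (w : InfinitePlace K) (R : ℝ) :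
    ∃ A c : ℝ, 0 ≤ A ∧ 0 ≤ c ∧ ∀ s ∈ {s : ℂ | |s.re| ≤ R},
      ‖(fun s : ℂ ↦ ((((1 / (Real.pi * mult w) : ℝ)) : ℂ) ^
        ((mult w : ℂ) * (s / 2) + (halfWeight K p w : ℂ)))⁻¹) s‖ ≤ A * Real.exp (c * ‖s‖ ^ 2) := by
  have hpos : (0 : ℝ) < 1 / (Real.pi * mult w) := by
    have : (0 : ℝ) < mult w := Nat.cast_pos.mpr mult_pos
    positivity
  have hb0 : (((1 / (Real.pi * mult w) : ℝ)) : ℂ) ≠ 0 := Complex.ofReal_ne_zero.mpr hpos.ne'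
  -- `b^{-(e s/2 + h)} = b^{-h} · b^{(-e/2) s}`
  have key := growth_mul (growth_const {s : ℂ | |s.re| ≤ R}
      ((((1 / (Real.pi * mult w) : ℝ)) : ℂ) ^ (-(halfWeight K p w : ℂ))))
    (growth_cpow_const_mul hpos (-(mult w : ℂ) / 2) (by simp) (R := R))
  refine growth_of_le (fun s _ ↦ le_of_eq ?_) key
  show ‖((((1 / (Real.pi * mult w) : ℝ)) : ℂ) ^ ((mult w : ℂ) * (s / 2) + (halfWeight K p w : ℂ)))⁻¹‖ =
    ‖(((1 / (Real.pi * mult w) : ℝ)) : ℂ) ^ (-(halfWeight K p w : ℂ)) *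
      (((1 / (Real.pi * mult w) : ℝ)) : ℂ) ^ (-(mult w : ℂ) / 2 * s)‖
  rw [← Complex.cpow_neg, ← Complex.cpow_add _ _ hb0]
  congr 2; ring

omit [NumberField K] in
/-- The factor `Γ(e_w s/2 + h_w)⁻¹` has growth `exp(O(‖s‖²))` on vertical strips. [folklore] -/
private theorem growth_inv_Gamma_halfWeight (p : Finset {w : InfinitePlace K // IsReal w}) (w : InfinitePlace K)
    {R : ℝ} (hR : 0 ≤ R) :
    ∃ A c : ℝ, 0 ≤ A ∧ 0 ≤ c ∧ ∀ s ∈ {s : ℂ | |s.re| ≤ R},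
      ‖(fun s : ℂ ↦ (Complex.Gamma ((mult w : ℂ) * (s / 2) + (halfWeight K p w : ℂ)))⁻¹) s‖ ≤
        A * Real.exp (c * ‖s‖ ^ 2) := by
  refine growth_of_le (fun s _ ↦ le_of_eq ?_)
    (growth_inv_Gamma_const_mul_add_real ((mult w : ℂ) / 2) (by simp) (halfWeight K p w) hR)
  show ‖(Complex.Gamma ((mult w : ℂ) * (s / 2) + (halfWeight K p w : ℂ)))⁻¹‖ =
    ‖(Complex.Gamma ((mult w : ℂ) / 2 * s + (halfWeight K p w : ℂ)))⁻¹‖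
  congr 3; ring

/-- **`A_p(s/2)⁻¹` on vertical strips**: `‖A_p(s/2)⁻¹‖ ≤ A exp(c‖s‖²)` for `|Re s| ≤ R`
(`A_p⁻¹ = ∏_w (π e_w)^{e_w s/2 + h_w} Γ(e_w s/2 + h_w)⁻¹`). [folklore] -/
private theorem growth_inv_gammaFactorCP (p : Finset {w : InfinitePlace K // IsReal w}) {R : ℝ} (hR : 0 ≤ R) :
    ∃ A c : ℝ, 0 ≤ A ∧ 0 ≤ c ∧ ∀ s ∈ {s : ℂ | |s.re| ≤ R},
      ‖(fun s : ℂ ↦ (gammaFactorCP K p (s / 2))⁻¹) s‖ ≤ A * Real.exp (c * ‖s‖ ^ 2) := by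
  have key := growth_prod (Finset.univ : Finset (InfinitePlace K)) (D := {s : ℂ | |s.re| ≤ R})
    (F := fun w s ↦ ((((1 / (Real.pi * mult w) : ℝ)) : ℂ) ^
        ((mult w : ℂ) * (s / 2) + (halfWeight K p w : ℂ)))⁻¹ *
      (Complex.Gamma ((mult w : ℂ) * (s / 2) + (halfWeight K p w : ℂ)))⁻¹)
    (fun w _ ↦ growth_mul (growth_inv_piFactor_halfWeight p w R) (growth_inv_Gamma_halfWeight p w hR))
  refine growth_of_le (fun s _ ↦ le_of_eq ?_) key
  show ‖(gammaFactorCP K p (s / 2))⁻¹‖ = _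
  rw [gammaFactorCP, ← Finset.prod_inv_distrib]
  congr 1
  exact Finset.prod_congr rfl fun w _ ↦ mul_inv _ _

/-! ### The signed coset series: entire part with growth -/

/-- **The entire part of the signed coset series has finite order on vertical strips** (Neukirch VII (8.5)
via (1.4) with growth): with the data of `exists_entire_signedCosetSum_eq_add_div`, there is an entire `E`
with `D_p(s) = E(s) + 2εg₀ c_N⁻¹ A_p(1/2)⁻¹/(s−1)` on `Re(s) > 1` AND `‖E(s)‖ ≤ A_R exp(c_R‖s‖²)` on every
strip `|Re s| ≤ R` — `E = c_N⁻¹A_p(s/2)⁻¹ Λ₀(s/2) − 2f₀·dslope(G,0) + 2εg₀·dslope(G,1)`, `G = c_N⁻¹A_p(s/2)⁻¹`,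
with `Λ₀` bounded on vertical strips (`weakFEPair_exists_norm_Λ₀_le`) and `1/Γ` of growth `exp(O(‖s‖²))`.
[cite: NeukirchANT1999, Ch. VII §1 (1.4) Theorem (proof) and §8 (8.5) Theorem] -/
theorem exists_entire_signedCosetSum_eq_add_div_growth (p : Finset {w : InfinitePlace K // IsReal w})
    (I : (FractionalIdeal (𝓞 K)⁰ K)ˣ) (a₀ : K) {N : ℕ} (hN0 : N ≠ 0) (hN : Even N)
    (hV : ∀ i, (((fundSystem K i : (𝓞 K)ˣ) : K) ^ N - 1) * a₀ ∈ (I : FractionalIdeal (𝓞 K)⁰ K)) :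
    ∃ E : ℂ → ℂ, Differentiable ℂ E ∧
      (∀ R : ℝ, 0 ≤ R → ∃ A c : ℝ, 0 ≤ A ∧ 0 ≤ c ∧ ∀ s ∈ {s : ℂ | |s.re| ≤ R},
        ‖E s‖ ≤ A * Real.exp (c * ‖s‖ ^ 2)) ∧
      ∀ s : ℂ, 1 < s.re →
      signedCosetSum K p (I : FractionalIdeal (𝓞 K)⁰ K) a₀ N s =
        E s + 2 * (heckePairW K p I a₀ N).ε * (heckePairW K p I a₀ N).g₀ *
          ((((pieceCst K N : ℝ) : ℂ))⁻¹ * (gammaFactorCP K p (1 / 2))⁻¹) / (s - 1) := by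
  set P := heckePairW K p I a₀ N with hP
  have hc0 : ((pieceCst K N : ℝ) : ℂ) ≠ 0 := Complex.ofReal_ne_zero.mpr (pieceCst_pos hN0).ne'
  set G : ℂ → ℂ := fun s ↦ (((pieceCst K N : ℝ) : ℂ))⁻¹ * (gammaFactorCP K p (s / 2))⁻¹ with hG
  have hGd : Differentiable ℂ G :=
    (differentiable_const _).mul ((differentiable_inv_gammaFactorCP p).comp (differentiable_id.div_const 2))
  have hGgr : ∀ R : ℝ, 0 ≤ R → ∃ A c : ℝ, 0 ≤ A ∧ 0 ≤ c ∧ ∀ s ∈ {s : ℂ | |s.re| ≤ R},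
      ‖G s‖ ≤ A * Real.exp (c * ‖s‖ ^ 2) := fun R hR ↦
    growth_of_le (fun s _ ↦ le_of_eq (by rw [hG, Pi.mul_apply]))
      (growth_mul (growth_const _ ((((pieceCst K N : ℝ) : ℂ))⁻¹)) (growth_inv_gammaFactorCP p hR))
  -- `f₀ · G(0) = 0`: either `p ≠ ∅` and `f₀ = 0`, or `p = ∅` and `A_∅(0)⁻¹ = 0`
  have hf0G : P.f₀ * G 0 = 0 := by
    by_cases hp : p = ∅
    · subst hp
      have : G 0 = 0 := by simp only [hG, zero_div, gammaFactorCP_empty_zero, inv_zero, mul_zero]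
      rw [this, mul_zero]
    · have : P.f₀ = 0 := by
        show heckeThetaConst K p (I : FractionalIdeal (𝓞 K)⁰ K) a₀ = 0
        simp [heckeThetaConst, hp]
      rw [this, zero_mul]
  refine ⟨fun s ↦ G s * P.Λ₀ (s / 2) - 2 * (P.f₀ * dslope G 0 s) + 2 * P.ε * P.g₀ * dslope G 1 s, ?_, ?_,
    fun s hs ↦ ?_⟩
  · have hΛ : Differentiable ℂ (fun s : ℂ ↦ P.Λ₀ (s / 2)) := P.differentiable_Λ₀.comp (differentiable_id.div_const 2)
    exact ((hGd.mul hΛ).sub ((differentiable_const _).mul ((differentiable_const _).mul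
      (differentiableOn_univ.mp ((Complex.differentiableOn_dslope Filter.univ_mem).mpr hGd.differentiableOn))))).add
      ((differentiable_const _).mul
        (differentiableOn_univ.mp ((Complex.differentiableOn_dslope Filter.univ_mem).mpr hGd.differentiableOn)))
  · intro R hR
    have key := growth_add
      (growth_sub (growth_mul (hGgr R hR) (growth_Λ₀_half P hR))
        (growth_mul (growth_const {s : ℂ | |s.re| ≤ R} 2)
          (growth_mul (growth_const {s : ℂ | |s.re| ≤ R} P.f₀) (growth_dslope hGd 0 (hGgr R hR)))))
      (growth_mul (growth_const {s : ℂ | |s.re| ≤ R} (2 * P.ε * P.g₀)) (growth_dslope hGd 1 (hGgr R hR)))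
    refine growth_of_le (fun s _ ↦ le_of_eq ?_) key
    simp only [Pi.add_apply, Pi.sub_apply, Pi.mul_apply]
  · have hs0 : s ≠ 0 := fun h ↦ by rw [h, Complex.zero_re] at hs; linarith
    have hs1 : s ≠ 1 := fun h ↦ by rw [h, Complex.one_re] at hs; linarith
    have hs1' : s - 1 ≠ 0 := sub_ne_zero.mpr hs1
    have hs' : 0 < (s / 2).re := by simp only [Complex.div_ofNat_re]; linarith
    have hA0 := gammaFactorCP_ne_zero p hs'
    -- `D_p(s) = G(s) Λ_P(s/2)`
    have hD : signedCosetSum K p (I : FractionalIdeal (𝓞 K)⁰ K) a₀ N s = G s * P.Λ (s / 2) := by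
      rw [hP, heckePairW_Λ_eq_signedCosetSum p I a₀ hN0 hN hV hs, hG]
      field_simp
    -- `Λ_P(s/2) = Λ₀(s/2) - f₀/(s/2) - ε g₀/(1/2 - s/2)`
    have hΛ : P.Λ (s / 2) = P.Λ₀ (s / 2) - (1 / (s / 2)) * P.f₀ - (P.ε / ((P.k : ℂ) - s / 2)) * P.g₀ := by
      simp only [WeakFEPair.Λ, smul_eq_mul]
    have hk : ((P.k : ℝ) : ℂ) = 1 / 2 := by
      rw [show P.k = 1 / 2 from rfl]; push_cast; ring
    have h0 : P.f₀ * dslope G 0 s = P.f₀ * G s / s := by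
      rw [dslope_of_ne _ hs0, slope_def_field, sub_zero, mul_div_assoc', mul_sub, hf0G, sub_zero]
    have h1 : dslope G 1 s = (G s - G 1) / (s - 1) := by
      rw [dslope_of_ne _ hs1, slope_def_field]
    have hG1 : G 1 = (((pieceCst K N : ℝ) : ℂ))⁻¹ * (gammaFactorCP K p (1 / 2))⁻¹ := rfl
    rw [hD, hΛ, hk]
    dsimp only
    rw [h0, h1, ← hG1]
    field_simp
    ring

/-- **Summing over the sign characters, with growth**: `Σ_p D_p(s) = E(s) + 2 ε_∅ c_N⁻¹ A_∅(1/2)⁻¹/(s-1)` on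
`Re(s) > 1` with `E` entire of growth `exp(O(‖s‖²))` on vertical strips. [cite: NeukirchANT1999, Ch. VII §8 (8.5) Theorem] -/
theorem exists_entire_sum_signedCosetSum_eq_add_div_growth (I : (FractionalIdeal (𝓞 K)⁰ K)ˣ) (a₀ : K) {N : ℕ}
    (hN0 : N ≠ 0) (hN : Even N)
    (hV : ∀ i, (((fundSystem K i : (𝓞 K)ˣ) : K) ^ N - 1) * a₀ ∈ (I : FractionalIdeal (𝓞 K)⁰ K)) :
    ∃ E : ℂ → ℂ, Differentiable ℂ E ∧
      (∀ R : ℝ, 0 ≤ R → ∃ A c : ℝ, 0 ≤ A ∧ 0 ≤ c ∧ ∀ s ∈ {s : ℂ | |s.re| ≤ R},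
        ‖E s‖ ≤ A * Real.exp (c * ‖s‖ ^ 2)) ∧
      ∀ s : ℂ, 1 < s.re →
      ∑ p : Finset {w : InfinitePlace K // IsReal w}, signedCosetSum K p (I : FractionalIdeal (𝓞 K)⁰ K) a₀ N s =
        E s + 2 * (heckePairW K ∅ I a₀ N).ε *
          ((((pieceCst K N : ℝ) : ℂ))⁻¹ * (gammaFactorCP K ∅ (1 / 2))⁻¹) / (s - 1) := by
  choose E hEd hEg hEs using fun p : Finset {w : InfinitePlace K // IsReal w} ↦
    exists_entire_signedCosetSum_eq_add_div_growth p I a₀ hN0 hN hV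
  refine ⟨fun s ↦ ∑ p, E p s, Differentiable.fun_sum fun p _ ↦ hEd p, fun R hR ↦ ?_, fun s hs ↦ ?_⟩
  · exact growth_sum (Finset.univ : Finset (Finset {w : InfinitePlace K // IsReal w})) (F := fun p s ↦ E p s)
      fun p _ ↦ hEg p R hR
  have hres : ∑ p : Finset {w : InfinitePlace K // IsReal w}, 2 * (heckePairW K p I a₀ N).ε *
      (heckePairW K p I a₀ N).g₀ * ((((pieceCst K N : ℝ) : ℂ))⁻¹ * (gammaFactorCP K p (1 / 2))⁻¹) =
      2 * (heckePairW K ∅ I a₀ N).ε * ((((pieceCst K N : ℝ) : ℂ))⁻¹ * (gammaFactorCP K ∅ (1 / 2))⁻¹) := by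
    rw [Finset.sum_eq_single (∅ : Finset {w : InfinitePlace K // IsReal w})]
    · have hg : (heckePairW K ∅ I a₀ N).g₀ = 1 := by
        show (if (∅ : Finset {w : InfinitePlace K // IsReal w}) = ∅ then (1 : ℂ) else 0) = 1
        exact if_pos rfl
      rw [hg, mul_one]
    · intro p _ hp
      have hg : (heckePairW K p I a₀ N).g₀ = 0 := by
        show (if p = ∅ then (1 : ℂ) else 0) = 0
        exact if_neg hp
      rw [hg, mul_zero, zero_mul]
    · exact fun h ↦ absurd (Finset.mem_univ _) h
  rw [Finset.sum_congr rfl fun p _ ↦ hEs p s hs, Finset.sum_add_distrib, ← Finset.sum_div, hres]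

end NumberField

end Literature.NumberTheory.LFunctions
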